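import Mathlib

/-!
# HodgeLocus census — GK wild corner ℓ = 3: anchors for σ_W = +1 (engine A, gen 38, DERIVATION-GK-A §5m)

Def-free, kernel-checked bookkeeping behind the derivation of the tangent-line Weil pairing of the basis
3-torsion points from Legendre's relation `η₂ω₁ − η₁ω₂ = 2πi` (`Im(ω₁/ω₂) > 0`):
`W(P, Q) = exp(−2πi·det(P,Q)/3)`, hence `W(ω₁/3, ω₂/3) = e^{−2πi/3}`, `1 + 2·W(ω₂/3, ω₁/3) = i√3`, `σ_W = +1`.
The analytic inputs (σ/ζ quasi-periodicity, residue theorem) are NOT formalised; these are the polynomial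
identities and the complex arithmetic the text uses.

certified instances and evidence bearing on the general Hodge conjecture; no claim.
-/

set_option linter.dupNamespace false

namespace Summit.HodgeConjecture.HodgeConjecture.HodgeLocus.Census.GKWeilSignAnchors

/-- Periodicity exponents of `f_P(z) = −e^{c_P z} σ(z − p)³/(σ(z)³σ(−p)³)` with `3p = aω₁ + bω₂`, `c_P = aη₁ + bη₂`:
`c_P ω₁ − 3p·η₁ = b(η₂ω₁ − η₁ω₂)` and `c_P ω₂ − 3p·η₂ = a(η₁ω₂ − η₂ω₁)` (both in `2πiℤ` by Legendre). -/
theorem periodicity_exponents {R : Type*} [CommRing R] (a b η₁ η₂ ω₁ ω₂ p3 : R) (h : p3 = a * ω₁ + b * ω₂) :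
    (a * η₁ + b * η₂) * ω₁ - p3 * η₁ = b * (η₂ * ω₁ - η₁ * ω₂) ∧
    (a * η₁ + b * η₂) * ω₂ - p3 * η₂ = a * (η₁ * ω₂ - η₂ * ω₁) := by
  subst h; constructor <;> ring

/-- The pairing exponent: `3·(c_P q − c_Q p) = (a₁η₁ + b₁η₂)(a₂ω₁ + b₂ω₂) − (a₂η₁ + b₂η₂)(a₁ω₁ + b₁ω₂) = det·(η₁ω₂ − η₂ω₁)`
with `det = a₁b₂ − a₂b₁`; with Legendre `η₁ω₂ − η₂ω₁ = −2πi` this is `−2πi·det`, i.e. `W(P,Q) = exp(−2πi·det/3)`. -/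
theorem pairing_exponent {R : Type*} [CommRing R] (a₁ b₁ a₂ b₂ η₁ η₂ ω₁ ω₂ : R) :
    (a₁ * η₁ + b₁ * η₂) * (a₂ * ω₁ + b₂ * ω₂) - (a₂ * η₁ + b₂ * η₂) * (a₁ * ω₁ + b₁ * ω₂) =
      (a₁ * b₂ - a₂ * b₁) * (η₁ * ω₂ - η₂ * ω₁) := by
  ring

/-- Independence of the representative: replacing `p` by `p + ω₁` (`a ↦ a + 3`, `c_P ↦ c_P + 3η₁`) changes the exponent
`c_P q − c_Q p` by `3η₁ q − c_Q ω₁ = η₁·(3q) − c_Q ω₁ = b₂(η₁ω₂ − η₂ω₁) ∈ 2πiℤ` (`3q = a₂ω₁ + b₂ω₂`). -/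
theorem representative_invariance {R : Type*} [CommRing R] (a₂ b₂ η₁ η₂ ω₁ ω₂ q3 : R) (h : q3 = a₂ * ω₁ + b₂ * ω₂) :
    η₁ * q3 - (a₂ * η₁ + b₂ * η₂) * ω₁ = b₂ * (η₁ * ω₂ - η₂ * ω₁) := by
  subst h; ring

/-- Orientation bookkeeping: `det(P₁, P₂) = 1`, `det(P₂, P₁) = −1` for `P₁ = ω₁/3 = (1,0)`, `P₂ = ω₂/3 = (0,1)`; and the
contour bookkeeping of Legendre's relation: `(−η₁ω₂) + (η₂ω₁) = η₂ω₁ − η₁ω₂`. -/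
theorem orientation_bookkeeping {R : Type*} [CommRing R] (η₁ η₂ ω₁ ω₂ : R) :
    ((1 : ℤ) * 1 - 0 * 0 = 1 ∧ (0 : ℤ) * 0 - 1 * 1 = -1) ∧ (-(η₁ * ω₂) + η₂ * ω₁ = η₂ * ω₁ - η₁ * ω₂) := by
  refine ⟨by norm_num, by ring⟩

/-- The check on `Λ = ℤi + ℤ` (`ω₁ = i`, `ω₂ = 1`, `η(1) = π`, `η(i) = −iπ`): `η₂ω₁ − η₁ω₂ = π·i − (−iπ)·1 = 2πi`. -/
theorem legendre_square_lattice : (Real.pi : ℂ) * Complex.I - (-Complex.I * Real.pi) * 1 = 2 * Real.pi * Complex.I := by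
  ring

/-- `1 + 2ω = i√3` for `ω = e^{2πi/3} = −1/2 + (√3/2) i`, and `(i√3)² = −3` (so `1 + 2·W(P₂,P₁) = +i√3`: `σ_W = +1`). -/
theorem one_add_two_omega :
    (1 : ℂ) + 2 * ((-1 / 2 : ℂ) + ((Real.sqrt 3 / 2 : ℝ) : ℂ) * Complex.I) = ((Real.sqrt 3 : ℝ) : ℂ) * Complex.I ∧
    (((Real.sqrt 3 : ℝ) : ℂ) * Complex.I) ^ 2 = -3 := by
  constructor
  · push_cast; ring
  · have h : (Real.sqrt 3) ^ 2 = 3 := Real.sq_sqrt (by norm_num)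
    rw [mul_pow, Complex.I_sq, ← Complex.ofReal_pow, h]; push_cast; ring

/-- `ω = −1/2 + (√3/2) i` is a primitive cube root of unity: `ω² + ω + 1 = 0` (so `W(P₂,P₁) = ω` has order 3, as a Weil pairing value of independent 3-torsion points must). -/
theorem omega_cube_root :
    ((-1 / 2 : ℂ) + ((Real.sqrt 3 / 2 : ℝ) : ℂ) * Complex.I) ^ 2 + ((-1 / 2 : ℂ) + ((Real.sqrt 3 / 2 : ℝ) : ℂ) * Complex.I) + 1 = 0 := by
  have h : (Real.sqrt 3) ^ 2 = 3 := Real.sq_sqrt (by norm_num)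
  have h2 : (((Real.sqrt 3 / 2 : ℝ) : ℂ)) ^ 2 = 3 / 4 := by
    rw [← Complex.ofReal_pow]; rw [div_pow, h]; push_cast; ring
  have hI : Complex.I ^ 2 = -1 := Complex.I_sq
  linear_combination (((Real.sqrt 3 / 2 : ℝ) : ℂ)) ^ 2 * hI - h2

end Summit.HodgeConjecture.HodgeConjecture.HodgeLocus.Census.GKWeilSignAnchors
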